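import Mathlib.Analysis.SpecialFunctions.Pow.Real
import Mathlib.Algebra.Order.Chebyshev
import HarnessLib

/-!
# K1L_D `LagrangianRenormalisationStepDesign` (stmt-AnomalousDissipation-27980), line «onelevel-design», stub `stub_oneLevelL_IW`:
# MODEWISE ASSEMBLY KIT for the window ledger (helper; `--supports … --as helper`; companion of `…WindowLedger` p644546 / `…WindowLedgerAbs` p645039)

Real-variable lemmas (no PDE, no Hilbert space) used by S3′ `stub_windowBookkeepingL` to turn PER-MODE window bounds (the shape delivered by S2′
`stub_distortedCellLawL`: sector-diagonal tracking errors `≤ η·a_ℓ·|σ_ℓ|` and cross-sector couplings of Schur-bounded bilinear shape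
`≤ η·K(ℓ,ℓ′)·a_ℓ|σ_ℓ|·b_{ℓ′}|y_{ℓ′}|`) into the DISSIPATION-DOMINATED hypothesis `|⟪y, e_k⟫| ≤ η·√(Σ a_ℓ²|σ_ℓ|²)·√(Σ b_ℓ′²|y_ℓ′|²)` of
`window_ledger` (lead-k1l-onelevel-p1 g2, L3 architecture, `Lines/onelevel-L3-stub-texts.md` §S3′(b)):
* `schur_sum_le` — the Schur test: row and column sums of `K ≥ 0` at most `1` ⇒ `Σ_{i,j} K i j · p i · q j ≤ √(Σ p²)·√(Σ q²)`;
* `dissip_lower_of_tracking` — if the exact window map sends the mode amplitudes `X i` to amplitudes `≤ λ i · X i + c i` (`0 ≤ λ ≤ 1`, leftovers `c ≥ 0`),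
  then its dissipation `Σ X² − Σ τ²` is at least `Σ (1 − λ²) X² − Σ (2 λ X c + c²)` (the weights `a_ℓ² = 1 − λ_ℓ²` of the ledger);
* `one_sub_le_one_sub_sq` — `1 − λ ≤ 1 − λ²` on `[0,1]` (tracking errors `∝ (1 − λ_ℓ)` are dominated by the dissipation weight; the conversion
  `min 1 (r̄t) ≲ 1 − q` is `…WindowRecursion.rateError_le_decayRel`, p642767).
Infrastructure for rung F-D1.A0; NOT a proof of the crux, of Onsager's conjecture or of anomalous dissipation.
-/

set_option linter.dupNamespace false

namespace Summit.AnomalousDissipation.AnomalousDissipation.Theorems.SolenoidalFractalHomogenisation.LagrangianStep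

noncomputable section

/-- **Schur test (finite, real).** If `K ≥ 0` has row sums and column sums at most `1` on `s × t`, then for nonnegative `p`, `q`:
`Σ_{i∈s} Σ_{j∈t} K i j · p i · q j ≤ √(Σ_{i∈s} p i²) · √(Σ_{j∈t} q j²)`. -/
theorem schur_sum_le {ι κ : Type*} (s : Finset ι) (t : Finset κ) (K : ι → κ → ℝ) (p : ι → ℝ) (q : κ → ℝ)
    (hK : ∀ i ∈ s, ∀ j ∈ t, 0 ≤ K i j) (hp : ∀ i ∈ s, 0 ≤ p i) (hq : ∀ j ∈ t, 0 ≤ q j)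
    (hrow : ∀ i ∈ s, ∑ j ∈ t, K i j ≤ 1) (hcol : ∀ j ∈ t, ∑ i ∈ s, K i j ≤ 1) :
    ∑ i ∈ s, ∑ j ∈ t, K i j * p i * q j ≤ Real.sqrt (∑ i ∈ s, p i ^ 2) * Real.sqrt (∑ j ∈ t, q j ^ 2) := by
  -- Cauchy–Schwarz on `s ×ˢ t` with `f (i,j) = √K · p i`, `g (i,j) = √K · q j`
  have hL : ∑ i ∈ s, ∑ j ∈ t, K i j * p i * q j =
      ∑ x ∈ s ×ˢ t, (Real.sqrt (K x.1 x.2) * p x.1) * (Real.sqrt (K x.1 x.2) * q x.2) := by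
    rw [Finset.sum_product]
    refine Finset.sum_congr rfl fun i hi => Finset.sum_congr rfl fun j hj => ?_
    have hk := hK i hi j hj
    calc K i j * p i * q j = (Real.sqrt (K i j) * Real.sqrt (K i j)) * p i * q j := by rw [Real.mul_self_sqrt hk]
      _ = _ := by ring
  have hCS := Finset.sum_mul_sq_le_sq_mul_sq (s ×ˢ t) (fun x => Real.sqrt (K x.1 x.2) * p x.1) (fun x => Real.sqrt (K x.1 x.2) * q x.2)
  have h1 : ∑ x ∈ s ×ˢ t, (Real.sqrt (K x.1 x.2) * p x.1) ^ 2 ≤ ∑ i ∈ s, p i ^ 2 := by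
    rw [Finset.sum_product]
    refine Finset.sum_le_sum fun i hi => ?_
    have : ∑ j ∈ t, (Real.sqrt (K i j) * p i) ^ 2 = p i ^ 2 * ∑ j ∈ t, K i j := by
      rw [Finset.mul_sum]
      refine Finset.sum_congr rfl fun j hj => ?_
      rw [mul_pow, Real.sq_sqrt (hK i hi j hj)]; ring
    rw [this]
    calc p i ^ 2 * ∑ j ∈ t, K i j ≤ p i ^ 2 * 1 := mul_le_mul_of_nonneg_left (hrow i hi) (sq_nonneg _)
      _ = p i ^ 2 := mul_one _
  have h2 : ∑ x ∈ s ×ˢ t, (Real.sqrt (K x.1 x.2) * q x.2) ^ 2 ≤ ∑ j ∈ t, q j ^ 2 := by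
    rw [Finset.sum_product_right]
    refine Finset.sum_le_sum fun j hj => ?_
    have : ∑ i ∈ s, (Real.sqrt (K i j) * q j) ^ 2 = q j ^ 2 * ∑ i ∈ s, K i j := by
      rw [Finset.mul_sum]
      refine Finset.sum_congr rfl fun i hi => ?_
      rw [mul_pow, Real.sq_sqrt (hK i hi j hj)]; ring
    rw [this]
    calc q j ^ 2 * ∑ i ∈ s, K i j ≤ q j ^ 2 * 1 := mul_le_mul_of_nonneg_left (hcol j hj) (sq_nonneg _)
      _ = q j ^ 2 := mul_one _
  have hP : 0 ≤ ∑ i ∈ s, p i ^ 2 := Finset.sum_nonneg fun i _ => sq_nonneg _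
  have hQ : 0 ≤ ∑ j ∈ t, q j ^ 2 := Finset.sum_nonneg fun j _ => sq_nonneg _
  have hLnn : 0 ≤ ∑ i ∈ s, ∑ j ∈ t, K i j * p i * q j :=
    Finset.sum_nonneg fun i hi => Finset.sum_nonneg fun j hj => mul_nonneg (mul_nonneg (hK i hi j hj) (hp i hi)) (hq j hj)
  have hsq : (∑ i ∈ s, ∑ j ∈ t, K i j * p i * q j) ^ 2 ≤ (∑ i ∈ s, p i ^ 2) * ∑ j ∈ t, q j ^ 2 := by
    rw [hL]
    exact hCS.trans (mul_le_mul h1 h2 (Finset.sum_nonneg fun x _ => sq_nonneg _) hP)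
  rw [← Real.sqrt_mul hP, ← Real.sqrt_sq hLnn]
  exact Real.sqrt_le_sqrt hsq

/-- On `[0,1]`, `1 − λ ≤ 1 − λ²`: a tracking error proportional to `1 − λ_ℓ` (the shape of the (V) rate error) is dominated by the
dissipation weight `1 − λ_ℓ²` of the window ledger. -/
theorem one_sub_le_one_sub_sq {l : ℝ} (h0 : 0 ≤ l) (h1 : l ≤ 1) : 1 - l ≤ 1 - l ^ 2 := by
  nlinarith

/-- **Dissipation lower bound from per-mode tracking.** If the window map sends mode amplitudes `X i ≥ 0` to amplitudes `τ i` with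
`0 ≤ τ i ≤ λ i · X i + c i` (intended: `0 ≤ λ i ≤ 1`, leftovers `c i ≥ 0`), and the image's energy is at most `Σ τ²` (Bessel), then the
dissipation is bounded below by the ledger weights: `Σ X² − E' ≥ Σ (1 − λ²)·X² − Σ (2·λ·X·c + c²)`. -/
theorem dissip_lower_of_tracking {ι : Type*} (s : Finset ι) (X τ lam c : ι → ℝ) {E' : ℝ}
    (hτ : ∀ i ∈ s, 0 ≤ τ i) (htrack : ∀ i ∈ s, τ i ≤ lam i * X i + c i) (hE : E' ≤ ∑ i ∈ s, τ i ^ 2) :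
    ∑ i ∈ s, (1 - lam i ^ 2) * X i ^ 2 - ∑ i ∈ s, (2 * lam i * X i * c i + c i ^ 2) ≤ ∑ i ∈ s, X i ^ 2 - E' := by
  have hτ2 : ∑ i ∈ s, τ i ^ 2 ≤ ∑ i ∈ s, (lam i * X i + c i) ^ 2 := by
    refine Finset.sum_le_sum fun i hi => ?_
    exact pow_le_pow_left₀ (hτ i hi) (htrack i hi) 2
  have hexp : ∑ i ∈ s, (lam i * X i + c i) ^ 2 =
      ∑ i ∈ s, X i ^ 2 - ∑ i ∈ s, (1 - lam i ^ 2) * X i ^ 2 + ∑ i ∈ s, (2 * lam i * X i * c i + c i ^ 2) := by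
    rw [← Finset.sum_sub_distrib, ← Finset.sum_add_distrib]
    refine Finset.sum_congr rfl fun i _ => ?_
    ring
  linarith

end

end Summit.AnomalousDissipation.AnomalousDissipation.Theorems.SolenoidalFractalHomogenisation.LagrangianStep
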